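import Summits.ResolutionOfSingularities.ResolutionOfSingularities.Theorems.EquisingularLiftEquisingularLiftNatTowerNestDefs
import HarnessLib

/-!
# [OURS · L1 W4.5(b) · EL♮(3) · IDEATOR 1 · card `toric-towers` ROUND 15] THE DEMAZURE / TORIC-CARRIER SUPPLIERS OF `DirStepUnobs` — typed first lemmas (SKETCH)

res-L1-w45b-idea-1 g24 (technique: characteristic-free combinatorial / toric).  NOT commissioned (desk R39 (i): `DirStepUnobs` stays a residue-side clause
certified per specimen); filed as the TYPED FIRST STEP of the card's ROUND 15 «DEMAZURE RESIDUE MAP».  Two `def … : Prop` (no axioms, no sorry, nothing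
asserted): each is a CLASSICAL, characteristic-free statement (Serre vanishing on `ℙ²`; Demazure vanishing for nef = basepoint-free invertible sheaves on the
Hirzebruch surface `𝔽_m`, [Fulton 1993, §3.5 Cor. p. 74; Demazure 1970]) phrased over the engine's OWN clause `DirStepUnobs` (`…NatDirZeroDefs`), so that —
once proved by a width hand — the `DirStepUnobs` hypothesis of `TowerNestB₅` (2) is discharged GENERICALLY (every curve in the fresh plane), and the same
clause one level up (curves in the ruled carrier `υ₃⁻¹ Z` over a RATIONAL `Z`, other than the host section) likewise.  OURS · counted 0 · AI-typed.
-/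

set_option linter.dupNamespace false

noncomputable section

open CategoryTheory CategoryTheory.Limits AlgebraicGeometry TopologicalSpace Topology IsLocalRing
open Literature.AlgebraicGeometry.Resolution
open AlgebraicGeometry.Scheme.IdealSheafData

namespace Summit.ResolutionOfSingularities.ResolutionOfSingularities.Cruxes.EquisingularLiftNat.Sections

/-- **(R15-D1) `DemazurePlaneSupplier k`** — «in a carrier `E ⊆ G` whose reduced structure is a projective PLANE `Ẽ ≅ ℙ²_k`, EVERY irreducible closed curve
`Γ ⊆ E` with regular reduced structure has UNOBSTRUCTED embedded deformations in `E`»: `DirStepUnobs G E hE Γ hΓ` for all such `Γ`.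
Mathematics (classical, any characteristic): `Γ̃ ⊂ ℙ²` is a smooth plane curve of some degree `d ≥ 1`, `𝒩_{Γ̃/ℙ²} = 𝒪_Γ̃(d)`, and
`H¹(ℙ², 𝒪(d)) = 0 = H²(ℙ², 𝒪)` give `H¹(Γ̃, 𝒪_Γ̃(d)) = 0` (equivalently: `deg 𝒩 = d² > 2g − 2 = d(d−3)`); Čech form on the cover by two affine opens
`Γ̃ ∖ S₀`, `Γ̃ ∖ S₁` (`S₀ ∩ S₁ = ∅` finite nonempty).  This discharges the `DirStepUnobs` clause of `TowerNestB₅` (2) for EVERY `Z` in the fresh plane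
`E' = υ₂⁻¹{y}` (given `Ẽ' ≅ ℙ²_k`, the exceptional divisor of a point blow-up of a regular threefold at a `k`-point).
[OURS · L1 W4.5b · IDEATOR 1 R15 · named statement (Prop), NOT proved here, NOT commissioned] -/
def DemazurePlaneSupplier (k : Type) [Field k] [IsAlgClosed k] : Prop :=
  ∀ (G : Scheme.{0}) (E : Set G) (hE : IsClosed E) (Γ : Set G) (hΓ : IsClosed Γ),
    Nonempty (redSub G E hE ≅ (Literature.AlgebraicGeometry.Motives.projectiveSpace 2 k).left) →
    Γ ⊆ E → Γ.Nonempty → IsIrreducible Γ →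
    (∀ z : redSub G Γ hΓ, IsRegularLocalRing ((redSub G Γ hΓ).presheaf.stalk z)) →
    (∀ z : ↥(redSub G Γ hΓ), IsClosed ({z} : Set ↥(redSub G Γ hΓ)) →
      ringKrullDim ((redSub G Γ hΓ).presheaf.stalk z) = ((1 : ℕ) : WithBot ℕ∞)) →
    DirStepUnobs G E hE Γ hΓ

/-- **(R15-D2) `DemazureNestCarrierSupplier k`** — the same one level up, in NEST's own letters: after the in-plane round `υ₃ = Bl_Z G'` at an irreducible
regular RATIONAL curve `Z` (`Z̃ ≅ ℙ¹_k`: a line or a conic of the fresh plane `E'`, `Ẽ' ≅ ℙ²_k`), EVERY irreducible regular closed curve `C` in the new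
ruled carrier `E'' = υ₃⁻¹ Z` OTHER THAN the host section `E'' ∩ St(E')` (typed: `¬ C ⊆ closure (υ₃⁻¹(E' ∖ Z))`) has `DirStepUnobs G'' E'' C`.
Mathematics (classical, any characteristic): `𝒩_{Z/G'} ≅ 𝒪_{ℙ¹}(e²) ⊕ 𝒪_{ℙ¹}(−e)` (`e = deg Z ∈ {1,2}`; the extension of `𝒩_{E'/G'}|_Z = 𝒪(−e)` by
`𝒩_{Z/E'} = 𝒪(e²)` splits since `H¹(ℙ¹, 𝒪(e² + e)) = 0`), so `Ẽ'' ≅ 𝔽_m`, `m = e² + e`, and the host section (sub-line-bundle `𝒩_{Z/E'}`) is THE negative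
section `σ₀` (`σ₀² = −m`); every other integral curve `C ∼ aσ₀ + bf` (`b ≥ am`) is NEF, hence basepoint-free on the toric surface `𝔽_m`, hence
`H¹(𝔽_m, 𝒪(C)) = 0` (DEMAZURE vanishing [Fulton 1993 §3.5 Cor.], characteristic-free) and `H²(𝒪_{𝔽_m}) = 0`, so `H¹(C, 𝒩_{C/E''}) = 0`.
[OURS · L1 W4.5b · IDEATOR 1 R15 · named statement (Prop), NOT proved here, NOT commissioned] -/
def DemazureNestCarrierSupplier (k : Type) [Field k] [IsAlgClosed k] : Prop :=
  ∀ (G' G'' : Scheme.{0}) (E' : Set G') (hE' : IsClosed E') (Z : Set G') (hZ : IsClosed Z) (υ₃ : G'' ⟶ G')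
      (C : Set G'') (hC : IsClosed C),
    Nonempty (redSub G' E' hE' ≅ (Literature.AlgebraicGeometry.Motives.projectiveSpace 2 k).left) →
    (∀ x : G', x ∈ E' → IsRegularLocalRing (G'.presheaf.stalk x)) →
    (∀ x : G', x ∈ E' → IsClosed ({x} : Set G') → ringKrullDim (G'.presheaf.stalk x) = ((3 : ℕ) : WithBot ℕ∞)) →
    Z ⊆ E' → Z.Nonempty → IsIrreducible Z →
    Nonempty (redSub G' Z hZ ≅ (Literature.AlgebraicGeometry.Motives.projectiveSpace 1 k).left) →
    IsBlowup υ₃ (Scheme.IdealSheafData.vanishingIdeal (⟨Z, hZ⟩ : Closeds G')) →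
    C ⊆ υ₃ ⁻¹' Z → C.Nonempty → IsIrreducible C →
    ¬ C ⊆ closure (υ₃ ⁻¹' (E' \ Z)) →
    (∀ z : redSub G'' C hC, IsRegularLocalRing ((redSub G'' C hC).presheaf.stalk z)) →
    (∀ z : ↥(redSub G'' C hC), IsClosed ({z} : Set ↥(redSub G'' C hC)) →
      ringKrullDim ((redSub G'' C hC).presheaf.stalk z) = ((1 : ℕ) : WithBot ℕ∞)) →
    DirStepUnobs G'' (υ₃ ⁻¹' Z) (IsClosed.preimage υ₃.base.hom.continuous hZ) C hC


/-! ## R15-3 — the EXPONENT BOOKKEEPING behind the «monic projection splitting» (the whole combinatorial content of `hsplit`, kernel-checked)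

For `Γ = V₊(q) ⊂ ℙ²`, `q` monic of degree `d` in `X₀`, a Laurent monomial `X₀^i X₁^a X₂^b` of total degree `0` (`a + b = −i`, `0 ≤ i < d`) on the overlap
`D₊(X₁X₂) ∩ Γ` is either regular on `D₊(X₁) ∩ Γ` (`b ≥ 0`) or equals `(X₂/X₁)^d · X₀^i X₁^{a+d} X₂^{b−d}` with `X₁^{a+d} X₂^{b−d}` regular on `D₊(X₂) ∩ Γ`
(`a + d ≥ 0`).  The dichotomy below is exactly that, and its sharp range `i ≤ d + 1` is `H¹(ℙ¹, 𝒪(d − i)) = 0 ⟺ d − i ≥ −1`. [OURS · pure arithmetic] -/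

/-- The exponent dichotomy of the two-chart Laurent splitting, in the range the plane-curve application uses (`i < d`). -/
theorem laurentSplit_exponents (d i : ℕ) (hi : i < d) (a b : ℤ) (h : a + b = -(i : ℤ)) : 0 ≤ b ∨ 0 ≤ a + d := by
  omega

/-- The same in the SHARP range `i ≤ d + 1` (`𝒪(m)` on `ℙ¹` splits on two charts iff `m ≥ −1`). -/
theorem laurentSplit_exponents_sharp (d i : ℕ) (hi : i ≤ d + 1) (a b : ℤ) (h : a + b = -(i : ℤ)) : 0 ≤ b ∨ 0 ≤ a + d := by
  omega

/-- And the range is sharp: for `i = d + 2` the monomial `X₀^i X₁^{−d−1} X₂^{−1}` is in neither part (`𝒪(−2)` on `ℙ¹` has `H¹ ≠ 0`). -/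
theorem laurentSplit_exponents_sharp_fails (d : ℕ) : ∃ a b : ℤ, a + b = -((d + 2 : ℕ) : ℤ) ∧ ¬ (0 ≤ b ∨ 0 ≤ a + d) :=
  ⟨-(d : ℤ) - 1, -1, by push_cast; ring, by omega⟩

end Summit.ResolutionOfSingularities.ResolutionOfSingularities.Cruxes.EquisingularLiftNat.Sections

end
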